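import Mathlib
import Summits.Ventures.HodgeRepro2.Tier7.Target

/-!
# Tier7/Line2/GaloisDefs — the rational structure, the eigen-periods, LEMMA A and the reordering lemmas (SUPPORT for Line 3)

SPLIT (1) of the Galois module (t7-plan-2's split ruling, STATUS l. 14988): this module = §1 conjugation / slots /
re-indexing, §2 `RationalStructure`, `eigenPeriod`, `GaloisRationality`, LEMMA A `L2_eq_mul_eigenPeriod` (PROVED,
t7-L1-p4), the reordering lemmas for anticommuting families (`prod_swap_eq_neg`, `prod_perm_eq_sign_zsmul`, used by
LEMMA C in `Tier7/Line2/Galois.lean`), and `eigenPeriod_ne_zero_iff`. Statements verbatim from t7-plan-2's v3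
(route/t7/Line2/Galois.lean 29201098…); namespace unchanged. The original v3 header follows.

# Tier7/Line2/Galois — the three seesaw realizations of one pairing (SUPPORT for Line 3's residual)

Filer: t7-plan-2 (gen 1, planner-pub-hodge-repro2-t7-plan-2-g1-0), on the t7-lead's answer STATUS l. 14933 to
CENSUS-g1 §3/§4 (conditions (1)–(4)). Status: v3 — INTERFACE MODULE: `RationalStructure`, `Realization`, `PermDatum` and the kernel bridge
`conclusion_perm_iff` (proved from LEMMAS A, C and the displayed `GaloisRationality`); A and C are the two remaining
`sorry` lemmas (prover t7-L1-p4); `GaloisRationality R` is proved for every `R` in `GaloisPeriod.lean` (p5, on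
`GaloisTrace.lean` p668640). Lane: support (`--supports` the Line-3 chain), NOT a line, NOT a device.

STRATEGY (CENSUS-g1.md §3). Let `v_i ∈ H¹(A_i, ℚ) = K` be rational generators of the four corners. For every
embedding `σ : K → ℂ` the σ-eigen-period `P_σ(g) = ∫_X ∏_i g_i • f_i^*(ε_{i,σ})` (`ε_σ` the σ-idempotent of
`K ⊗_ℚ ℂ ≅ ∏_σ ℂ`) is the σ-conjugate `σ(c(g))` of ONE element `c(g) ∈ K` (Galois rationality of a rational period
functional on the Weil line — Tier 4's `f_forall`, BridgeTrace p387267; RE-PROVED here over the displayed fields,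
never imported: `GaloisRationality`, proved in `GaloisPeriod.lean`). Hence `P_s(g) ≠ 0 ⟺ P_σ(g) ≠ 0` for every `σ`. At an embedding `σ` lying in
`T (π 0) ∩ T (π 1)` (so `σ̄ ∈ T (π 2) ∩ T (π 3)`, `IsWeilFace`) the σ-eigen-period IS the L² pairing
`⟨θ'_{π0} ∧ θ'_{π1}, θ'_{π2} ∧ θ'_{π3}⟩` of the Galois-conjugated theta lifts — the datum `PermDatum D R r` with the
corners permuted by `π`, base embedding `σ`, eigenvectors `ε_{·,σ}` / `ε_{·,σ̄}`, summands `omegaAt`. The kernel bridge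
`conclusion_perm_iff : C (PermDatum D R r) ↔ C D` is uniform in `D`.

WHAT IT BUYS LINE 3 (and nothing more): the residual `shrink ∧ orb_γ₀` (Line3.RtfShadow, lead l. 14836/14881) may be
discharged on WHICHEVER of the three seesaw planes `W_0^{(j)} ⊕ W_j^{(j)}` (j = 1, 2, 3; three torus pairs, three sets of
local factors) has the easiest local factors — e.g. if an archimedean matrix coefficient `⟨τ(γ₀)u_B, u_A⟩` vanished on
one plane, another plane is available — and transported back to `C D` by `conclusion_perm_iff`
(`rtfConclusion_perm_iff` transports `Line3.RtfConclusion` under any per-datum bridge `RtfConclusion ↔ C`).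
MODULE CHAIN (every module sorry-free at the gate): `GaloisTrace` (number-field facts) → `Eps` (the idempotents exist)
→ this module → `GaloisPeriod` (`galoisRationality`) → `GaloisBridge` (the unconditional `conclusion_perm_iff`)
→ `SquareZeroInstance` (the (A′) instance).

(A′) / (3): `RationalStructure D` is an INTERFACE a junk datum carries too — every field is a printed fact about the
real objects and holds in the square-zero model (crit-1 JunkModel-frozen 9c0b26dd…: products of 1-classes `= 0`
⟹ `anticomm`; `intX = 0` ⟹ `rat`; `bar = conj ⊗ conjH1` ⟹ `alb_conj`; the idempotents of `ℚ(ζ₇) ⊗ ℂ` ⟹ `eps_*`,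
`eigen_dim`, `eps_conj`; `omegaAt i σ := ℂ • alb (slot i (eps σ))`, irreducible for `G = Unit` ⟹ `omegaAt_*`);
`SquareZeroInstance.lean` states and proves the generic instance. No field closes `C D` on its own (`rat` is an
equation with an unknown rational, `GaloisRationality` an equation with an unknown `c ∈ K`).

§8(d): this module proposes NO L-value-free non-vanishing device — support only (flexibility of the plane).

FIELD LOCATORS: see the docstring of each field of `RationalStructure` / `Realization`.
-/

namespace Summit.Ventures.HodgeRepro2.Tier7.Line2.Galois

open Summit.Ventures.HodgeRepro2 (IsWeilFace IsCMType)
open Summit.Ventures.HodgeRepro2.T6 (KC H1C eigenLine eigenLineK)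
open Summit.Ventures.HodgeRepro2.Tier7

noncomputable section

variable {K : Type} [Field K] [NumberField K] {E' : Type} [Field E'] [NumberField E']
  {V : Type} [AddCommGroup V] [Module E' V] {HX : Type} [Ring HX] [Algebra ℂ HX]
  {G : Type} [Group G] [MulAction G HX]

/-! ## 1. Conjugation and slots on `H¹(B, ℂ) = Fin 4 → K ⊗ ℂ` -/

/-- the conjugate embedding `σ̄ = conj ∘ σ` (the frozen `hs2`/`hs3` use exactly this form) -/
abbrev conjEmb (σ : K →+* ℂ) : K →+* ℂ := (starRingEnd ℂ).comp σ

/-- the vector `u` placed in the `i`-th corner (`eigenLine K i σ = (eigenLineK K σ).map (slot i)`) -/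
def slot (i : Fin 4) : KC K →ₗ[ℂ] H1C K := LinearMap.single ℂ (fun _ : Fin 4 => KC K) i

/-- complex conjugation on `K ⊗_ℚ ℂ`, acting on the coefficient: `c ⊗ x ↦ c̄ ⊗ x` (ℚ-algebra map, ℂ-antilinear) -/
def conjKC (K : Type) [Field K] [NumberField K] : KC K →ₐ[ℚ] KC K :=
  Algebra.TensorProduct.map (starRingEnd ℂ).toRatAlgHom (AlgHom.id ℚ K)

/-- complex conjugation on `H¹(B, ℂ)`, corner by corner -/
def conjH1 (v : H1C K) : H1C K := fun i => conjKC K (v i)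

/-- the rational class `1 ⊗ x` of `H¹(A_i, ℚ) = K` -/
def ratVec (x : K) : KC K := Algebra.TensorProduct.includeRight x

/-- re-indexing of the corners by a permutation: `(reindex π v) j = v (π⁻¹ j)`, so `reindex π (slot i u) = slot (π i) u` -/
def reindex (π : Equiv.Perm (Fin 4)) : H1C K →ₗ[ℂ] H1C K := LinearMap.funLeft ℂ (KC K) π.symm

/-- re-indexing moves the `i`-th corner to the `π i`-th -/
theorem reindex_slot (π : Equiv.Perm (Fin 4)) (i : Fin 4) (u : KC K) :
    reindex π (slot i u) = slot (π i) u := by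
  funext j
  simp only [reindex, slot, LinearMap.funLeft_apply, LinearMap.single_apply]
  by_cases h : j = π i
  · subst h; simp
  · have h' : π.symm j ≠ i := fun h'' => h (by rw [← h'']; simp)
    simp [h, h']

/-- conjugation acts slot by slot -/
theorem conjH1_slot (i : Fin 4) (u : KC K) : conjH1 (slot i u) = slot i (conjKC K u) := by
  funext j
  simp only [conjH1, slot, LinearMap.single_apply]
  by_cases h : j = i
  · subst h; simp
  · simp [h]

omit [NumberField K] in
/-- `IsWeilFace` is invariant under permuting the four corners. -/
theorem isWeilFace_comp_perm {T : Fin 4 → Set (K →+* ℂ)} (h : IsWeilFace K T) (π : Equiv.Perm (Fin 4)) :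
    IsWeilFace K (fun i => T (π i)) := by
  refine ⟨fun i => h.1 (π i), fun φ => ?_⟩
  rw [← h.2 φ]
  exact Nat.card_congr (Equiv.subtypeEquiv π (fun i => Iff.rfl))

/-! ## 2. The rational structure (interface; every field a printed fact about the real objects) -/

/-- A rational structure on a period datum: the σ-idempotents of `K ⊗ ℂ`, the real structure and rationality of the
surface shadow relative to the corners, and the Hecke summands of all eigen-components.
LOCATORS. `eps_*`, `eigen_dim`, `eps_conj`: `K ⊗_ℚ ℂ ≅ ∏_{σ : K → ℂ} ℂ` for `K/ℚ` separable (Bourbaki, Algèbre V §6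
no 7, Prop. 7 / Mathlib `Algebra.IsSeparable`); Tier 4 Theorem A1(i) (A1EigenlineDecompositionGalois: each `ℓ_{i,σ}`
is a line) — cited, not imported. `alb_conj`: `f_i^*` is the pull-back of a morphism of varieties, hence compatible
with the real structures of Betti cohomology (Voisin, Hodge Theory I, §6.1; Griffiths–Harris p. 116). `anticomm`:
graded commutativity of the cup product in degree 1 (Hatcher Thm 3.14; Bredon VI.4.3); Hecke translates preserve
the degree. `rat`: `∫_X` is ℚ-valued on `H⁴(X, ℚ)` (Bredon VI.8.3), `f_i^*` and the Hecke correspondences are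
algebraic hence rational on Betti cohomology (Fulton Cor. 19.2; Liu 2021 §4: the `f_i` are morphisms over a number
field). `omegaAt_*`: Liu 2021 Prop. 4.13 (every Hecke-irreducible summand of `H^{1,0}`) and its `Aut(ℂ)`-conjugates
(the σ-eigen-components of `H¹(A_i, ℚ)` lie in the conjugated summands `ω(μ_i^σ)`), Cor. 4.20 (LIT-INDEX-lit-1);
(H11a): the centre acts on an irreducible summand by a scalar (Schur). -/
structure RationalStructure (D : PeriodDatum K E' V HX G) where
  /-- the σ-idempotent `ε_σ ∈ K ⊗ ℂ` -/
  eps : (K →+* ℂ) → KC K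
  /-- `(1 ⊗ x) ε_σ = σ(x) ε_σ` (so `ε_σ ∈ eigenLineK K σ`) -/
  eps_eigen : ∀ (σ : K →+* ℂ) (x : K), ratVec x * eps σ = σ x • eps σ
  eps_ne : ∀ σ, eps σ ≠ 0
  /-- `∑_σ ε_σ = 1` -/
  eps_sum : ∑ σ : K →+* ℂ, eps σ = 1
  /-- every σ-eigenvector is a multiple of `ε_σ` (the eigenlines are lines) -/
  eigen_dim : ∀ (σ : K →+* ℂ) (u : KC K), u ∈ eigenLineK K σ → ∃ c : ℂ, u = c • eps σ
  /-- conjugation permutes the idempotents: `ε̄_σ = ε_{σ̄}` (derivable from `eps_eigen`, `eps_sum`, `eigen_dim`) -/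
  eps_conj : ∀ σ, conjKC K (eps σ) = eps (conjEmb σ)
  /-- `f^*` commutes with complex conjugation -/
  alb_conj : ∀ v : H1C K, D.S.bar (D.alb v) = D.alb (conjH1 v)
  /-- graded commutativity in degree 1, for Hecke translates of pulled-back 1-classes -/
  anticomm : ∀ (g h : G) (v w : H1C K), (g • D.alb v) * (h • D.alb w) = -((h • D.alb w) * (g • D.alb v))
  /-- rationality: the period of a product of Hecke-translated pull-backs of rational classes is rational -/
  rat : ∀ (g : Fin 4 → G) (x : Fin 4 → K), ∃ q : ℚ,
    D.S.intX (g 0 • D.alb (slot 0 (ratVec (x 0))) * g 1 • D.alb (slot 1 (ratVec (x 1))) *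
      g 2 • D.alb (slot 2 (ratVec (x 2))) * g 3 • D.alb (slot 3 (ratVec (x 3)))) = (q : ℂ)
  /-- the Hecke summand containing the σ-eigen-component of the `i`-th corner -/
  omegaAt : Fin 4 → (K →+* ℂ) → Submodule ℂ HX
  omegaAt_le : ∀ (i : Fin 4) (σ : K →+* ℂ), σ ∈ D.F.T i → omegaAt i σ ≤ D.S.H10
  omegaAt_irred : ∀ (i : Fin 4) (σ : K →+* ℂ), HeckeIrred G (omegaAt i σ)
  alb_eps_mem : ∀ (i : Fin 4) (σ : K →+* ℂ), D.alb (slot i (eps σ)) ∈ omegaAt i σ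
  omegaAt_center_scalar : ∀ (i : Fin 4) (σ : K →+* ℂ), ∀ z ∈ Subgroup.center G,
    ∃ c : ℂ, ∀ a ∈ omegaAt i σ, z • a = c • a

variable {D : PeriodDatum K E' V HX G}

/-- the σ-eigen-period of the translates `g`: `∫_X ∏_i g_i • f_i^*(ε_{i,σ})` (canonical corner order) -/
def eigenPeriod (R : RationalStructure D) (σ : K →+* ℂ) (g : Fin 4 → G) : ℂ :=
  D.S.intX (g 0 • D.alb (slot 0 (R.eps σ)) * g 1 • D.alb (slot 1 (R.eps σ)) *
    g 2 • D.alb (slot 2 (R.eps σ)) * g 3 • D.alb (slot 3 (R.eps σ)))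

/-! ## 3. The three lemmas (sorried in this skeleton) -/

omit [NumberField K] in
/-- conjugating an embedding twice gives it back -/
theorem conjEmb_conjEmb (σ : K →+* ℂ) : conjEmb (conjEmb σ) = σ := by
  ext x
  simp [conjEmb]

/-- `bar` of a translated pull-back of the `σ̄`-idempotent is the translated pull-back of the `σ`-idempotent
(`bar_act`, `alb_conj`, `conjH1_slot`, `eps_conj`) -/
theorem bar_smul_alb_eps (R : RationalStructure D) (g : G) (i : Fin 4) (σ : K →+* ℂ) :
    D.S.bar (g • D.alb (slot i (R.eps (conjEmb σ)))) = g • D.alb (slot i (R.eps σ)) := by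
  rw [D.S.bar_act, R.alb_conj, conjH1_slot, R.eps_conj, conjEmb_conjEmb]

/-- an eigenvector of the `i`-th corner at `σ` is a non-zero multiple of `slot i (ε_σ)` when it is non-zero -/
theorem eq_smul_slot_eps (R : RationalStructure D) (i : Fin 4) (σ : K →+* ℂ) {v : H1C K}
    (hv : v ∈ eigenLine K i σ) (hne : v ≠ 0) : ∃ c : ℂ, c ≠ 0 ∧ v = c • slot i (R.eps σ) := by
  obtain ⟨u, hu, rfl⟩ := Submodule.mem_map.mp hv
  obtain ⟨c, rfl⟩ := R.eigen_dim σ u hu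
  refine ⟨c, ?_, ?_⟩
  · rintro rfl
    apply hne
    simp
  · simp [slot]

/-- LEMMA A. The frozen pairing is a non-zero multiple of the `s`-eigen-period: `e i = c_i • slot i (ε_{s or s̄})`
(`eigen_dim`), `bar` of the `s̄`-side is the `s`-side (`alb_conj`, `eps_conj`), and `L2 = intX (· * bar ·)`.
PROOF: `intX` of the product of the four translated pull-backs of the idempotents, times the scalar `c₀ c₁ c̄₂ c̄₃`. -/
theorem L2_eq_mul_eigenPeriod (R : RationalStructure D) :
    ∃ c : ℂ, c ≠ 0 ∧ ∀ g : Fin 4 → G,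
      D.S.L2 (D.fOmegaS g) (D.fOmegaSbar g) = c * eigenPeriod R D.s g := by
  obtain ⟨c0, hc0, he0⟩ := eq_smul_slot_eps R 0 D.s D.e0_mem (D.e_ne 0)
  obtain ⟨c1, hc1, he1⟩ := eq_smul_slot_eps R 1 D.s D.e1_mem (D.e_ne 1)
  obtain ⟨c2, hc2, he2⟩ := eq_smul_slot_eps R 2 (conjEmb D.s) D.e2_mem (D.e_ne 2)
  obtain ⟨c3, hc3, he3⟩ := eq_smul_slot_eps R 3 (conjEmb D.s) D.e3_mem (D.e_ne 3)
  refine ⟨c0 * c1 * (starRingEnd ℂ) c2 * (starRingEnd ℂ) c3, ?_, ?_⟩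
  · simp [hc0, hc1, hc2, hc3]
  intro g
  have key : ∀ (h : G) (c : ℂ) (v : H1C K), h • D.alb (c • v) = c • (h • D.alb v) := by
    intro h c v
    rw [map_smul, D.S.act_smul]
  simp only [SurfaceShadow.L2, PeriodDatum.fOmegaS, PeriodDatum.fOmegaSbar, PeriodDatum.theta, eigenPeriod,
    he0, he1, he2, he3, key, D.S.bar_mul, D.S.bar_smul, bar_smul_alb_eps]
  simp only [smul_mul_assoc, mul_smul_comm, smul_smul, map_smul, smul_eq_mul, mul_assoc]
  ring

/-- GALOIS RATIONALITY of the eigen-periods (Tier 4's `f_forall` p387267, cited, never imported): for every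
translate `g` the σ-eigen-periods are the conjugates `σ c` of ONE element `c ∈ K`. Stated as a `Prop` on the rational
structure; PROVED for every `R` in `Tier7/Line2/GaloisPeriod.lean` (imports this module + `GaloisTrace`), by the
trace-dual-basis argument: `1 ⊗ x = ∑_σ σ(x) ε_σ` (`eps_sum`, `eps_eigen`); trace-dual bases `x_k, y_k` of `K/ℚ`
(`traceForm_nondegenerate ℚ K`) with `∑_k σ(y_k) τ(x_k) = [σ = τ]` (`GaloisTrace.sum_dualBasis_mul_eq`); the rational Weil
class `W(g; x) = ∑_{k,l,m} (g_0 • f_0^*(x y_k)) (g_1 • f_1^*(x_k y_l)) (g_2 • f_2^*(x_l y_m)) (g_3 • f_3^*(x_m))` has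
`intX W(g; x) = ∑_σ σ(x) P_σ(g)` and is rational (`rat`); a rational-valued ℚ-linear functional is `Tr(c ·)`
(`GaloisTrace.exists_linear_of_rat`, `exists_trace_dual`); `trace_eq_sum_ringHom` and Dedekind
(`GaloisTrace.eq_zero_of_sum_embeddings`) give `P_σ(g) = σ c`. Until that module lands this is the DISPLAYED
hypothesis of the bridge (the t7-lead's fallback form, STATUS l. 14933 (4)). -/
def GaloisRationality (R : RationalStructure D) : Prop :=
  ∀ g : Fin 4 → G, ∃ c : K, ∀ σ : K →+* ℂ, eigenPeriod R σ g = σ c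

/-- Galois transport of non-vanishing (from Galois rationality). -/
theorem eigenPeriod_ne_zero_iff {R : RationalStructure D} (hB : GaloisRationality R) (σ τ : K →+* ℂ)
    (g : Fin 4 → G) : eigenPeriod R σ g ≠ 0 ↔ eigenPeriod R τ g ≠ 0 := by
  obtain ⟨c, hc⟩ := hB g
  rw [hc σ, hc τ]
  exact ⟨fun h => (map_ne_zero τ).2 ((map_ne_zero σ).1 h), fun h => (map_ne_zero σ).2 ((map_ne_zero τ).1 h)⟩

/-! ## 3b. Reordering lemmas for anticommuting families (used by LEMMA C) -/

omit [Algebra ℂ HX] in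
/-- the four-fold product of an anticommuting family, with the positions `x ≠ y` exchanged, changes sign -/
theorem prod_swap_eq_neg (c : Fin 4 → HX) (hac : ∀ k l, c k * c l = -(c l * c k)) (x y : Fin 4) (hxy : x ≠ y) :
    c (Equiv.swap x y 0) * c (Equiv.swap x y 1) * c (Equiv.swap x y 2) * c (Equiv.swap x y 3) =
      -(c 0 * c 1 * c 2 * c 3) := by
  have hac' : ∀ k l (z : HX), c k * (c l * z) = -(c l * (c k * z)) := by
    intro k l z
    rw [← mul_assoc, hac k l, neg_mul, mul_assoc]
  have h10 := hac 1 0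
  have h20 := hac 2 0
  have h30 := hac 3 0
  have h21 := hac 2 1
  have h31 := hac 3 1
  have h32 := hac 3 2
  have h10' := hac' 1 0
  have h20' := hac' 2 0
  have h30' := hac' 3 0
  have h21' := hac' 2 1
  have h31' := hac' 3 1
  have h32' := hac' 3 2
  fin_cases x <;> fin_cases y <;>
    first
    | exact absurd rfl hxy
    | (simp only [Equiv.swap_apply_def, Fin.isValue, Fin.mk_zero, Fin.reduceEq, ↓reduceIte, Fin.reduceFinMk]
       simp only [mul_assoc]
       simp only [h20, h21, h32, h10', h20', h30', h21', h31', mul_neg, neg_neg])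

omit [Algebra ℂ HX] in
/-- the four-fold product of an anticommuting family, re-indexed by a permutation, is the sign times the
canonical product -/
theorem prod_perm_eq_sign_zsmul (b : Fin 4 → HX) (hac : ∀ k l, b k * b l = -(b l * b k))
    (π : Equiv.Perm (Fin 4)) :
    b (π 0) * b (π 1) * b (π 2) * b (π 3) = (Equiv.Perm.sign π : ℤ) • (b 0 * b 1 * b 2 * b 3) := by
  revert b
  induction π using Equiv.Perm.swap_induction_on' with
  | one =>
    intro b _
    simp
  | mul_swap f x y hxy ih =>
    intro b hac
    have hc : ∀ k l, (b ∘ f) k * (b ∘ f) l = -((b ∘ f) l * (b ∘ f) k) := fun k l => hac _ _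
    have h1 := prod_swap_eq_neg (b ∘ f) hc x y hxy
    simp only [Function.comp] at h1
    simp only [Equiv.Perm.mul_apply]
    rw [h1, ih b hac, Equiv.Perm.sign_mul, Equiv.Perm.sign_swap hxy, Units.val_mul, Units.val_neg,
      Units.val_one, mul_neg, mul_one, neg_zsmul]

end

end Summit.Ventures.HodgeRepro2.Tier7.Line2.Galois
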